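import Literature.MathematicalPhysics.QuantumFieldTheory.Balaban1983to89.Node00.OpsYGauge
import Literature.MathematicalPhysics.QuantumFieldTheory.Balaban1983to89.B6Partition118KLevelTorus
import Literature.MathematicalPhysics.QuantumFieldTheory.Balaban1983to89.B9Thm37Sum

/-!
# `Balaban1983to89.B9Thm37CubeCoverCommutators` — T. Bałaban, *Propagators for lattice gauge theories in a background field*,
# Commun. Math. Phys. **99** (1985) 389–434 [Balaban1985BackgroundPropagators], Sect. C pp. 408–409, (3.87)–(3.88): PRINT'S COMMUTATOR
# `K(h)` OF A CUT-OFF `h` WITH THE GENUINE COVARIANT OPERATOR `Δ′_a(U)` OF (3.24) — exact stencil, locality, gauge covariance — AND THE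
# ALGEBRA «Δ′_a G′₀ = I − Σ_□ K(h_□)G′_□h_□ = I − R′» AT def-Y's TORUS LETTERS (sub-row G-B9-LETTERS, module M5.4-comb: the combinatorial
# half of Theorem 3.7's input; the estimate (3.89) is the other half and is NOT here)

statement-level skeleton of published theorems with citation tags; proofs where landed; nothing here is a claim about the Yang–Mills mass gap

PDF held: `paper:balaban1985-cmp99-background-propagators` (journal page = PDF page + 388); pp. 408–409 read this generation as page images
`pub/pub-balaban/b2b-balaban-ref1/pages/1985-cmp99-background-propagators/…-p020-x2.png`, `…-p021-x2.png` and as text layers `p0020.txt`,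
`p0021.txt`.  [4] = T. Bałaban, *Propagators and renormalization transformations for lattice gauge theories. II*, Commun. Math. Phys. **96** (1984)
223–250 [Balaban1984PropagatorsII] ((2.36) p. 229, (2.38)–(2.39) p. 229).

CITATION HEADER (lean-in-tree rule) — WHAT IS PRINTED (verbatim up to notation).  p. 408: *«We take a family 𝒟_j of cubes □, with centers at
points of this lattice, which are unions of 2ᵈ big blocks, with at least one of them contained in Bʲ(Λ_j). A union of these families for all j is
denoted by 𝒟. … The family 𝒟 is a partition of the lattice T. We take the partition of unity {h_□} defined at the end of Sect. A in [4]. We have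
Σ_{□∈𝒟} h_□² = 1.»*  p. 409: *«We construct approximations G′₀, C₀, G₀ of the operators G′, (Q′G′²Q′\*)⁻¹, G taking G′₀ = Σ_{□∈𝒟} h_□G′_□h_□,
C₀ = Σ_{□∈𝒟} h_□C_□h_□, G₀ = Σ_{□∈𝒟} h_□G_□h_□. (3.87)  As in [4] we have to express the operators Δ′_aG′₀, (Q′G′²Q′)C₀, Δ_aG₀ as small
perturbations of identity. Let us start with the operator Δ′_aG′₀. Using (3.50) we get for x ∈ Δ(y), y ∈ Λ_j,
(Δ′_a hλ)(x) = h(x)(Δ′_aλ)(x) − Σ_{b∈st(x)} (∂h)(b)(Dλ)(b) + (Δh)(x)λ(x)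
  + a_j(Lʲη)⁻² Σ_{x′∈Bʲ(y)} L^{−jd}(∂h)(Γ^{(j)}_{x,y} ∪ Γ^{(j)}_{y,x′})R((U(Γ^{(j)}_{y,x}))⁻¹R(U(Γ^{(j)}_{y,x′}))λ(x′) = h(x)(Δ′_aλ)(x) − (K(h)λ)(x), (3.88)
hence Δ′_aG′₀ = I − Σ_□ K(h_□)G′_□h_□ = I − R′.»*  p. 410: *«the operator K(h) is semi-local»*.  [4] p. 229, (2.38)–(2.39): *«Δ′_aG′₀ = I −
Σ_□ K(h_□)G′(□)h_□ = I − R, (2.38) where (K(h)λ)(x) = Σ_{b∈st(x)} (∂h)(b)(∂λ)(b) − (Δh)(x)λ(x) − a_j(Lʲη)⁻² Σ_{x′∈Bʲ(yʲ(x))} L^{−jd}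
(∂h)(Γ^{(j)}_{x,yʲ(x),x′})λ(x′) if x ∈ Bʲ(Λ_j). (2.39)»*.

CELL ∕ SUB-ROW.  Cell `lit-balaban` (HOME `run/shared/lean/pub/lit-balaban/`), sub-row G-B9-LETTERS = [Balaban1985BackgroundPropagators]
Thms 3.1–3.3 for a GENERAL regular background `U₀` on the torus `T_η` (map of record `lit-balaban-r06/B9-LETTERS-MAP.md` §4, module **M5.4-comb**);
seat p38 gen 37 (literature-prover-lit-balaban-p38-g37-0), lead g29 GO 2026-08-28T01:07Z.  SKELETON rows B9.Thm3.7 × B9.Def@408 (cells; decls of record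
untouched).

## WHAT IS ALREADY IN THE TREE, CITED BY NAME (not retyped).  The carrier is def-Y's NODE 00 box chart `Node00.SiteY i = ↥(boxDom (N0 ℓ i.Mh i.k i.P′))`
of a k-level member `i : KIdx` (pub-ymgap seat `dag-n06-a` = def-Y, `Node00.OpsYOfLetters`), on which live: the cube family `𝒟 = cubes i.D.toDomains`
(p21, `B6Cover236MultiLevelBlocks`; print's «unions of 2ᵈ big blocks, with centers at points of this lattice» = [4] (2.36)); THE PARTITION OF UNITY
`h_□ = B6Partition118KLevelTorus.hT i.D □ : SiteY i → ℝ` (this seat's gen 26) with `Σ_□ h_□² = 1` (`sum_hT_sq`), `0 ≤ h_□ ≤ 1`, support in `QT □ ⊂ □̃ =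
QbigT □`, the flat cut-off `zetaT`, first differences `≤ C1F∕(8∕5·bigSide_j)` = print's `|∂h_□| ≤ O(1)(MLʲη)⁻¹` and second differences
`≤ C2F∕(8∕5·bigSide_j)²` (`B6Partition118KLevelTorusBinders.partition118_torus`); the overlap count `#{□ : y ∈ QbigT □} ≤ 3·9^{d+1}` (r03,
`B6Cover236QbigOverlapV1.card_filter_mem_QbigT_le`); THE GENUINE `Δ′_a(U)` of (3.24): def-Y's `Node00.deltaPrimeAY i par U = lapSL i U + kernelTrOpY
(avgCoeffY i) (avgTrY i par U)` (`Node00.OpsYDeltaPrimeA`) with its gauge covariance `Node00.deltaPrimeAY_cov` (`Node00.OpsYGauge`); the abstract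
summation algebra `B9Thm37Sum.eq388_sum ∕ fixedPoint_of_388` (b09).

## WHAT THIS FILE ADDS (kernel-checked, 0 sorry, standard axioms; DEFINITIONS WITH BODIES + THEOREMS; no `def … : Prop`, no new fact)
* §1 `cutMulY h` — multiplication of `𝔸`-valued lattice functions by a REAL function `h` (= def-Y's `liftMatY 𝔸 (Matrix.diagonal h)`,
  `cutMulY_eq_liftMatY_diagonal`), its composition law, and `Σ_□ cutMulY h_□ ∘ cutMulY h_□ = 1` for any family with `Σ_□ h_□² = 1`
  (`sum_cutMulY_mul_self`) — the `hpu` of `B9Thm37Sum.eq388_sum`; gauge covariance `intw_cutMulY`.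
* §2 `cutCommY h A := cutMulY h ∘ A − A ∘ cutMulY h` — PRINT'S SIGN: `A(hΛ) = h·AΛ − K(h)Λ` (`mul_cutMulY_eq`, the `h388` shape of `eq388_sum`);
  additivity in `A`; vanishing for constant `h`; covariance transfer `intw_cutCommY`.
* §3 ★ THE AVERAGING LINE OF (3.88), EXACTLY: `cutCommY h (kernelTrOpY K T) = kernelTrOpY (fun z w ↦ K z w · (h z − h w)) T` for ANY real kernel
  and ANY transporter table (print's `(∂h)(Γ_{x,y} ∪ Γ_{y,x′})` is the telescoped `h(x′) − h(x)` along the contour; we keep the difference).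
* §4 ★ THE COVARIANT-LAPLACIAN LINE OF (3.88), EXACTLY (def-Y's lattice units, `z ± e_μ = (shiftY i μ)^{±1} z`, `U_μ = UboxY i U μ`):
  `(cutCommY h (lapSL i U) Λ)(z) = Σ_μ [(h(z+e_μ) − h z)•R(U_μ(z))Λ(z+e_μ) + (h(z−e_μ) − h z)•R(U_μ(z−e_μ))⁻¹Λ(z−e_μ)]` — a BOND-LOCAL FIRST-ORDER
  operator whose coefficients are the bond differences `(∂h)(b)`, `b ∈ st(z)` (`cutCommY_lapSL_apply`).
* §5 ★★ `KhY i par h U := cutCommY h (Node00.deltaPrimeAY i par U)` — PRINT'S `K(h)` AT THE GENUINE `Δ′_a(U)`, generic in the transporter letter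
  `par` (so def-Y's v4 letter of record `par := parSymY` is covered): `KhY_eq_add` (§4-part + §3-part), `KhY_apply` (the full stencil),
  `deltaPrimeAY_mul_cutMulY` (the `h388` identity `Δ′_a(U)∘h = h∘Δ′_a(U) − K(h)`), `KhY_cov` ((3.31)-type covariance `K(h)(U^u)R(u) = R(u)K(h)(U)`).
* §6 LOCALITY (p. 410 «K(h) is semi-local»): `stencilY i z` = `{z, z ± e_μ} ∪ {w : avgCoeffY i z w ≠ 0}` (the lattice neighbours and the `L^{lev z}`-block
  of `z`); `KhY_apply_eq_zero_of_const` (`(K(h)Λ)(z) = 0` if `h` is constant on the stencil), `KhY_apply_congr` (`(K(h)Λ)(z)` depends on `Λ` on the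
  stencil only), `cutMulY_mul_KhY_eq_zero` (THE WALK ADJACENCY VANISHING behind «□ᵢ ∩ □ᵢ₊₁ ≠ ∅» in (3.90): `g·K(h) = 0` when `h` is constant on the
  stencil of every point of `supp g`).
* §7 ★★ (3.87)–(3.88) SUMMED AT THE LETTERS: for ANY real family `hf` with `Σ_c hf_c² = 1` and ANY cube-operator family `Gl c` with the LOCAL-INVERSE
  property `h_c Δ′_a(U) G_c h_c = h_c²` (G′_□ inverts Δ′_a on the functions living where h_□ does — the content of M5.1a ∕ M5.2, a HYPOTHESIS here):
  `Δ′_a(U) · (Σ_c h_c G_c h_c) = 1 − Σ_c K(h_c)(U) G_c h_c` (`eq388_deltaPrimeAY`, = `B9Thm37Sum.eq388_sum` in the ring `Module.End ℂ (SiteY i → 𝔸)`),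
  the fixed-point form `G′ = G′₀ + G′R′` for any left inverse `G′` of `Δ′_a(U)` (`fixedPoint388_deltaPrimeAY`), and both AT THE PARTITION OF RECORD
  `hf := hT i.D` (`eq388_hT`, `fixedPoint388_hT`; `hpu` DISCHARGED by `sum_hT_sq` from `i.hM8`, `i.hP5`).

HONEST SCOPE ∕ DIVERGENCES.  (1) Print's sign conventions: our `lapSL` is def-Y's `Σ_μ ∇*_{U,μ}∇_{U,μ}` (positive), so the first line of (3.88) appears
as §4's two-sided difference formula; the dictionary to «Σ_{b∈st(x)}(∂h)(b)(D_Uλ)(b) + (Δh)(x)λ(x)» is `R(U_μ z)Λ(z+e_μ) = (∇_{U,μ}Λ)(z) + Λ(z)`.  (2) The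
averaging transporter is def-Y's `par U z c · par U c w` through the block CORNER `c` (print: the block's reference point `y`, `R(U(Γ_{y,x}))⁻¹R(U(Γ_{y,x′}))`);
n06-j's located finding R7 (`B9Thm311DeltaPrimeSymm`) and def-Y's route (S) (`parSymY`) are covered by genericity in `par`.  (3) Lattice units (`η`
absorbed as in all of NODE 00).  (4) NOT here: the estimate (3.89) (needs (3.42) for `G′_□` — M5.2 ∕ M5.4-est), the cube-local operators `G′_□` of the
sequence `{Ω_n(□)}` (M5.1a), Lemma 2.1, Theorem 3.7 itself (M5.5); nothing continuum ∕ OS ∕ mass gap ∕ Clay.  YM mass gap NOT proved by any of this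
(Track A conditional rung).  `--supports stmt-QuantumFields-19200`.  Net new unproved facts: 0.
-/

noncomputable section

namespace Literature.MathematicalPhysics.QuantumFieldTheory.Balaban1983to89.B9Thm37CubeCoverCommutators

open Node00
open B6KLevelCensusIndexV1 (KIdx)
open B6Cover236MultiLevelBlocks (cubes)
open B6Partition118KLevelTorus (hT sum_hT_sq)
open B9Eq39Adjoint (R R_one R_add R_sub R_smul R_zero R_inv_R)
open scoped Matrix

variable {𝔸 : Type} [NormedRing 𝔸] [NormedAlgebra ℂ 𝔸] [CompleteSpace 𝔸]

/-! ## §1 Multiplication by a real cut-off -/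

section CutMul

variable {X : Type}

/-- **multiplication by a real lattice function** `h` on `𝔸`-valued functions: `(h·Λ)(z) = h(z)Λ(z)` (the cut-offs `h_□` of (3.87)).
[cite: Balaban1985BackgroundPropagators, (3.87) p.409] -/
def cutMulY (h : X → ℝ) : (X → 𝔸) →ₗ[ℂ] (X → 𝔸) where
  toFun Λ := fun z => ((h z : ℝ) : ℂ) • Λ z
  map_add' Λ Λ' := by
    funext z
    simp only [Pi.add_apply, smul_add]
  map_smul' c Λ := by
    funext z
    simp only [Pi.smul_apply, RingHom.id_apply, smul_comm c]

omit [CompleteSpace 𝔸] in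
/-- the cut-off multiplication, evaluated. [cite: Balaban1985BackgroundPropagators, (3.87) p.409, bookkeeping] -/
@[simp] theorem cutMulY_apply (h : X → ℝ) (Λ : X → 𝔸) (z : X) : cutMulY (𝔸 := 𝔸) h Λ z = ((h z : ℝ) : ℂ) • Λ z := rfl

omit [CompleteSpace 𝔸] in
/-- it IS def-Y's lift of the diagonal real matrix `diag h` (so every NODE 00 lemma on `liftMatY` applies).
[cite: Balaban1985BackgroundPropagators, (3.87) p.409, dictionary] -/
theorem cutMulY_eq_liftMatY_diagonal [Fintype X] [DecidableEq X] (h : X → ℝ) :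
    cutMulY (𝔸 := 𝔸) h = liftMatY 𝔸 (Matrix.diagonal h) := by
  refine LinearMap.ext fun Λ => funext fun z => ?_
  rw [cutMulY_apply, liftMatY_diagonal_apply]

omit [CompleteSpace 𝔸] in
/-- composition law: `h·(h′·Λ) = (hh′)·Λ`. [cite: Balaban1985BackgroundPropagators, (3.87) p.409, bookkeeping] -/
theorem cutMulY_mul (h h' : X → ℝ) :
    cutMulY (𝔸 := 𝔸) h * cutMulY h' = cutMulY (fun z => h z * h' z) := by
  refine LinearMap.ext fun Λ => funext fun z => ?_
  rw [Module.End.mul_apply, cutMulY_apply, cutMulY_apply, cutMulY_apply, smul_smul, ← Complex.ofReal_mul]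

omit [CompleteSpace 𝔸] in
/-- the constant cut-off `1` multiplies as the identity. [cite: Balaban1985BackgroundPropagators, (3.87) p.409, bookkeeping] -/
theorem cutMulY_one : cutMulY (𝔸 := 𝔸) (fun _ : X => (1 : ℝ)) = 1 := by
  refine LinearMap.ext fun Λ => funext fun z => ?_
  rw [cutMulY_apply, Complex.ofReal_one, one_smul, Module.End.one_apply]

omit [CompleteSpace 𝔸] in
/-- additivity in the cut-off. [cite: Balaban1985BackgroundPropagators, (3.87) p.409, bookkeeping] -/
theorem cutMulY_add (h h' : X → ℝ) : cutMulY (𝔸 := 𝔸) (fun z => h z + h' z) = cutMulY h + cutMulY h' := by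
  refine LinearMap.ext fun Λ => funext fun z => ?_
  rw [LinearMap.add_apply, Pi.add_apply, cutMulY_apply, cutMulY_apply, cutMulY_apply, Complex.ofReal_add, add_smul]

omit [CompleteSpace 𝔸] in
/-- subtraction in the cut-off. [cite: Balaban1985BackgroundPropagators, (3.87) p.409, bookkeeping] -/
theorem cutMulY_sub (h h' : X → ℝ) : cutMulY (𝔸 := 𝔸) (fun z => h z - h' z) = cutMulY h - cutMulY h' := by
  refine LinearMap.ext fun Λ => funext fun z => ?_
  rw [LinearMap.sub_apply, Pi.sub_apply, cutMulY_apply, cutMulY_apply, cutMulY_apply, Complex.ofReal_sub, sub_smul]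

omit [CompleteSpace 𝔸] in
/-- **«We have Σ_{□∈𝒟} h_□² = 1»** as an operator identity: `Σ_□ (h_□·)(h_□·) = 1` for any real family with `Σ_□ h_□² = 1` pointwise — the
hypothesis `hpu` of `B9Thm37Sum.eq388_sum`. [cite: Balaban1985BackgroundPropagators, p.408 («Σ h_□² = 1»)] -/
theorem sum_cutMulY_mul_self {ι : Type} [Fintype ι] (hf : ι → X → ℝ) (hsq : ∀ z, ∑ c, hf c z ^ 2 = 1) :
    ∑ c, cutMulY (𝔸 := 𝔸) (hf c) * cutMulY (hf c) = 1 := by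
  refine LinearMap.ext fun Λ => funext fun z => ?_
  rw [LinearMap.sum_apply, Finset.sum_apply, Module.End.one_apply]
  simp_rw [Module.End.mul_apply, cutMulY_apply, smul_smul, ← Complex.ofReal_mul]
  rw [← Finset.sum_smul, ← Complex.ofReal_sum]
  have h1 : ∑ c, hf c z * hf c z = 1 := by simpa only [sq] using hsq z
  rw [h1, Complex.ofReal_one, one_smul]

omit [CompleteSpace 𝔸] in
/-- a real cut-off commutes with the gauge action `R(u)` (3.28): `(h·) R(u) = R(u) (h·)`.
[cite: Balaban1985BackgroundPropagators, (3.28) p.395, (3.30) p.395] -/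
theorem intw_cutMulY (γ : X → 𝔸ˣ) (h : X → ℝ) : Intw (conjY γ) (conjY γ) (cutMulY (𝔸 := 𝔸) h) (cutMulY h) := by
  refine LinearMap.ext fun Λ => funext fun z => ?_
  show cutMulY h (conjY γ Λ) z = R (γ z) (cutMulY h Λ z)
  rw [cutMulY_apply, cutMulY_apply, conjY_apply, R_smul]

end CutMul

/-! ## §2 The commutator `K(h)` of a cut-off with an operator — print's sign -/

section CutComm

variable {X : Type}

/-- **`K(h)` for an operator `A`**: `K(h) := (h·)∘A − A∘(h·)`, so that `A(hΛ) = h·(AΛ) − K(h)Λ` — the sign of (3.88) «(Δ′_a hλ)(x) = h(x)(Δ′_aλ)(x) −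
(K(h)λ)(x)». [cite: Balaban1985BackgroundPropagators, (3.88) p.409] -/
def cutCommY (h : X → ℝ) (A : (X → 𝔸) →ₗ[ℂ] (X → 𝔸)) : (X → 𝔸) →ₗ[ℂ] (X → 𝔸) :=
  cutMulY h * A - A * cutMulY h

omit [CompleteSpace 𝔸] in
/-- `K(h)`, evaluated: `(K(h)Λ)(z) = h(z)(AΛ)(z) − (A(hΛ))(z)`. [cite: Balaban1985BackgroundPropagators, (3.88) p.409, bookkeeping] -/
theorem cutCommY_apply (h : X → ℝ) (A : (X → 𝔸) →ₗ[ℂ] (X → 𝔸)) (Λ : X → 𝔸) (z : X) :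
    cutCommY h A Λ z = ((h z : ℝ) : ℂ) • A Λ z - A (cutMulY h Λ) z := by
  rw [cutCommY, LinearMap.sub_apply, Pi.sub_apply, Module.End.mul_apply, Module.End.mul_apply, cutMulY_apply]

omit [CompleteSpace 𝔸] in
/-- ★ **THE `h388` SHAPE** of `B9Thm37Sum.eq388_sum`: `A∘(h·) = (h·)∘A − K(h)` («(Δ′_a hλ) = h(Δ′_aλ) − K(h)λ»).
[cite: Balaban1985BackgroundPropagators, (3.88) p.409] -/
theorem mul_cutMulY_eq (h : X → ℝ) (A : (X → 𝔸) →ₗ[ℂ] (X → 𝔸)) :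
    A * cutMulY h = cutMulY h * A - cutCommY h A := by
  rw [cutCommY, sub_sub_cancel]

omit [CompleteSpace 𝔸] in
/-- `K(h)` is additive in the operator (so `K(h)` of `Δ′_a = Δ_U + (averaging)` splits into the two display lines of (3.88)).
[cite: Balaban1985BackgroundPropagators, (3.88) p.409, bookkeeping] -/
theorem cutCommY_add (h : X → ℝ) (A B : (X → 𝔸) →ₗ[ℂ] (X → 𝔸)) :
    cutCommY h (A + B) = cutCommY h A + cutCommY h B := by
  simp only [cutCommY, mul_add, add_mul]
  abel

omit [CompleteSpace 𝔸] in
/-- a CONSTANT cut-off commutes with every (ℂ-linear) operator: `K(c) = 0`. [cite: Balaban1985BackgroundPropagators, (3.88) p.409, bookkeeping] -/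
theorem cutCommY_const (c : ℝ) (A : (X → 𝔸) →ₗ[ℂ] (X → 𝔸)) : cutCommY (fun _ : X => c) A = 0 := by
  have hc : cutMulY (𝔸 := 𝔸) (fun _ : X => c) = ((c : ℝ) : ℂ) • (1 : Module.End ℂ (X → 𝔸)) := by
    refine LinearMap.ext fun Λ => funext fun z => ?_
    rw [cutMulY_apply, LinearMap.smul_apply, Module.End.one_apply, Pi.smul_apply]
  rw [cutCommY, hc, smul_mul_assoc, one_mul, mul_smul_comm, mul_one, sub_self]

omit [CompleteSpace 𝔸] in
/-- `K(h)` INHERITS GAUGE COVARIANCE: if `A(U^u)R(u) = R(u)A(U)` then `K(h)(U^u)R(u) = R(u)K(h)(U)` (the cut-off commutes with `R(u)`).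
[cite: Balaban1985BackgroundPropagators, (3.28)–(3.33) pp.395–396] -/
theorem intw_cutCommY (γ : X → 𝔸ˣ) (h : X → ℝ) {A A' : (X → 𝔸) →ₗ[ℂ] (X → 𝔸)}
    (hA : Intw (conjY γ) (conjY γ) A A') : Intw (conjY γ) (conjY γ) (cutCommY h A) (cutCommY h A') :=
  ((intw_cutMulY γ h).comp hA).sub (hA.comp (intw_cutMulY γ h))

end CutComm

/-! ## §3 The averaging line of (3.88): the commutator with a transported kernel operator, exactly -/

section Kernel

variable {X : Type} [Fintype X]

omit [CompleteSpace 𝔸] in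
/-- ★ **THE SECOND DISPLAY LINE OF (3.88)**: for a kernel operator with transport `(K♯_T Λ)(z) = Σ_w K(z,w)•R(T(z,w))Λ(w)` (def-Y's averaging term
`Σ_j a_j(Lʲη)⁻² Q′_j(U)* 1_{Λ_j} Q′_j(U)` has this form), the commutator with a real cut-off is the kernel operator with kernel `K(z,w)·(h(z) − h(w))`
and the SAME transport — print's `L^{−jd}(∂h)(Γ_{x,y} ∪ Γ_{y,x′})R(U(Γ_{y,x}))⁻¹R(U(Γ_{y,x′}))`, the contour difference kept as `h(x) − h(x′)`.
[cite: Balaban1985BackgroundPropagators, (3.88) p.409 (second line)] -/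
theorem cutCommY_kernelTrOpY (h : X → ℝ) (K : X → X → ℝ) (T : X → X → 𝔸ˣ) :
    cutCommY h (kernelTrOpY K T) = kernelTrOpY (fun z w => K z w * (h z - h w)) T := by
  refine LinearMap.ext fun Λ => funext fun z => ?_
  rw [cutCommY_apply, kernelTrOpY_apply, kernelTrOpY_apply, kernelTrOpY_apply, Finset.smul_sum, ← Finset.sum_sub_distrib]
  refine Finset.sum_congr rfl fun w _ => ?_
  rw [cutMulY_apply, R_smul, smul_smul, smul_smul, ← sub_smul, ← Complex.ofReal_mul, ← Complex.ofReal_mul, ← Complex.ofReal_sub]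
  congr 1
  push_cast
  ring

omit [CompleteSpace 𝔸] in
/-- the averaging commutator, evaluated. [cite: Balaban1985BackgroundPropagators, (3.88) p.409 (second line), bookkeeping] -/
theorem cutCommY_kernelTrOpY_apply (h : X → ℝ) (K : X → X → ℝ) (T : X → X → 𝔸ˣ) (Λ : X → 𝔸) (z : X) :
    cutCommY h (kernelTrOpY K T) Λ z = ∑ w, (((K z w * (h z - h w) : ℝ)) : ℂ) • R (T z w) (Λ w) := by
  rw [cutCommY_kernelTrOpY, kernelTrOpY_apply]

end Kernel

/-! ## §4 The covariant-Laplacian line of (3.88): a bond-local first-order operator, exactly -/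

section Laplacian

variable {d ℓ : ℕ} {hd : 1 ≤ d + 1} {hL : Odd (ℓ + 1) ∧ 1 < ℓ + 1} {b₀ b₁ : ℝ}
variable (i : KIdx d ℓ hd hL b₀ b₁)

/-- `∇_{U,μ}` of a cut-off product, evaluated: `(∇_{U,μ}(hΛ))(z) = h(z+e_μ)•R(U_μ z)Λ(z+e_μ) − h(z)•Λ(z)`.
[cite: Balaban1985BackgroundPropagators, (3.3) p.390, (3.100) p.413 («(D_μ hA)(x) = h(x)(D_μA)(x) + (∂_μh)(x)R(U(x,x+ηe_μ))A(x+ηe_μ)»)] -/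
theorem cdS_cutMulY_apply (U : CfgY 𝔸 i) (μ : Fin (d + 1)) (h : SiteY i → ℝ) (Λ : SiteY i → 𝔸) (z : SiteY i) :
    cdS i U μ (cutMulY h Λ) z
      = ((h (shiftY i μ z) : ℝ) : ℂ) • R (UboxY i U μ z) (Λ (shiftY i μ z)) - ((h z : ℝ) : ℂ) • Λ z := by
  show R (UboxY i U μ z) (cutMulY h Λ (shiftY i μ z)) - cutMulY h Λ z = _
  rw [cutMulY_apply, cutMulY_apply, R_smul]

/-- `∇*_{U,μ}∇_{U,μ}` of a cut-off product, evaluated (the transporters `R(U_μ(z−e_μ))⁻¹R(U_μ(z−e_μ))` cancel on the diagonal term):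
`(∇*∇(hΛ))(z) = 2h(z)Λ(z) − h(z−e_μ)•R(U_μ(z−e_μ))⁻¹Λ(z−e_μ) − h(z+e_μ)•R(U_μ z)Λ(z+e_μ)`.
[cite: Balaban1985BackgroundPropagators, (3.23) p.394, (3.100) p.413] -/
theorem cdsS_cdS_cutMulY_apply (U : CfgY 𝔸 i) (μ : Fin (d + 1)) (h : SiteY i → ℝ) (Λ : SiteY i → 𝔸) (z : SiteY i) :
    cdsS i U μ (cdS i U μ (cutMulY h Λ)) z
      = (2 : ℂ) • (((h z : ℝ) : ℂ) • Λ z)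
        - ((h ((shiftY i μ).symm z) : ℝ) : ℂ) • R (UboxY i U μ ((shiftY i μ).symm z))⁻¹ (Λ ((shiftY i μ).symm z))
        - ((h (shiftY i μ z) : ℝ) : ℂ) • R (UboxY i U μ z) (Λ (shiftY i μ z)) := by
  show R (UboxY i U μ ((shiftY i μ).symm z))⁻¹ (cdS i U μ (cutMulY h Λ) ((shiftY i μ).symm z)) - cdS i U μ (cutMulY h Λ) z = _
  rw [cdS_cutMulY_apply, cdS_cutMulY_apply, Equiv.apply_symm_apply, R_sub, R_smul, R_smul, R_inv_R, two_smul]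
  abel

/-- ★ **THE FIRST DISPLAY LINE OF (3.88)** at def-Y's covariant Laplacian `Δ_U = Σ_μ ∇*_{U,μ}∇_{U,μ}` (lattice units): the commutator with a real
cut-off is the BOND-LOCAL FIRST-ORDER operator
`(K_Δ(h)Λ)(z) = Σ_μ [(h(z+e_μ) − h(z))•R(U_μ(z))Λ(z+e_μ) + (h(z−e_μ) − h(z))•R(U_μ(z−e_μ))⁻¹Λ(z−e_μ)]`
— coefficients = the bond differences `(∂h)(b)`, `b ∈ st(z)` (print: «Σ_{b∈st(x)}(∂h)(b)(Dλ)(b) + (Δh)(x)λ(x)», with `R(U_b)λ(b₊) = (D_Uλ)(b) + λ(x)`).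
[cite: Balaban1985BackgroundPropagators, (3.88) p.409 (first line); Balaban1984PropagatorsII, (2.39) p.229] -/
theorem cutCommY_lapSL_apply (U : CfgY 𝔸 i) (h : SiteY i → ℝ) (Λ : SiteY i → 𝔸) (z : SiteY i) :
    cutCommY h (lapSL i U) Λ z
      = ∑ μ : Fin (d + 1),
          ((((h (shiftY i μ z) - h z : ℝ)) : ℂ) • R (UboxY i U μ z) (Λ (shiftY i μ z))
            + (((h ((shiftY i μ).symm z) - h z : ℝ)) : ℂ) • R (UboxY i U μ ((shiftY i μ).symm z))⁻¹ (Λ ((shiftY i μ).symm z))) := by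
  rw [cutCommY_apply, lapSL_apply, lapSL_apply]
  show ((h z : ℝ) : ℂ) • (∑ μ : Fin (d + 1), cdsS i U μ (cdS i U μ Λ) z)
      - ∑ μ : Fin (d + 1), cdsS i U μ (cdS i U μ (cutMulY h Λ)) z = _
  have h1 : ∀ μ : Fin (d + 1), cdsS i U μ (cdS i U μ Λ) z
      = (2 : ℂ) • Λ z - R (UboxY i U μ ((shiftY i μ).symm z))⁻¹ (Λ ((shiftY i μ).symm z))
          - R (UboxY i U μ z) (Λ (shiftY i μ z)) := fun μ => by
    have e := cdsS_cdS_cutMulY_apply (𝔸 := 𝔸) i U μ (fun _ => (1 : ℝ)) Λ z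
    have e1 : cutMulY (𝔸 := 𝔸) (fun _ : SiteY i => (1 : ℝ)) Λ = Λ := by
      rw [cutMulY_one, Module.End.one_apply]
    rw [e1] at e
    rw [e]
    simp only [Complex.ofReal_one, one_smul]
  simp_rw [h1, cdsS_cdS_cutMulY_apply, Finset.smul_sum, ← Finset.sum_sub_distrib]
  refine Finset.sum_congr rfl fun μ _ => ?_
  rw [Complex.ofReal_sub, Complex.ofReal_sub, sub_smul, sub_smul, smul_sub, smul_sub, smul_comm ((h z : ℝ) : ℂ) (2 : ℂ) (Λ z)]
  abel

/-- the same line in PRINT'S SHAPE «Σ_{b∈st(x)}(∂h)(b)(D_Uλ)(b) + (Δh)(x)λ(x)» (our `Δh = Σ_μ (h(z+e_μ) + h(z−e_μ) − 2h(z))`, our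
`∇*_{U,μ}` along the reversed bond): `(K_Δ(h)Λ)(z) = Σ_μ [(h(z+e_μ) − h z)•(∇_{U,μ}Λ)(z) + (h(z−e_μ) − h z)•(∇*_{U,μ}Λ)(z)] + (Δh)(z)•Λ(z)`.
[cite: Balaban1985BackgroundPropagators, (3.88) p.409 (first line)] -/
theorem cutCommY_lapSL_apply_print (U : CfgY 𝔸 i) (h : SiteY i → ℝ) (Λ : SiteY i → 𝔸) (z : SiteY i) :
    cutCommY h (lapSL i U) Λ z
      = (∑ μ : Fin (d + 1),
          ((((h (shiftY i μ z) - h z : ℝ)) : ℂ) • cdS i U μ Λ z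
            + (((h ((shiftY i μ).symm z) - h z : ℝ)) : ℂ) • cdsS i U μ Λ z))
        + ((((∑ μ : Fin (d + 1), (h (shiftY i μ z) + h ((shiftY i μ).symm z) - 2 * h z)) : ℝ) : ℂ)) • Λ z := by
  rw [cutCommY_lapSL_apply, Complex.ofReal_sum, Finset.sum_smul, ← Finset.sum_add_distrib]
  refine Finset.sum_congr rfl fun μ _ => ?_
  have e1 : cdS i U μ Λ z = R (UboxY i U μ z) (Λ (shiftY i μ z)) - Λ z := rfl
  have e2 : cdsS i U μ Λ z = R (UboxY i U μ ((shiftY i μ).symm z))⁻¹ (Λ ((shiftY i μ).symm z)) - Λ z := rfl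
  rw [e1, e2, smul_sub, smul_sub]
  have e3 : ((((h (shiftY i μ z) + h ((shiftY i μ).symm z) - 2 * h z)) : ℝ) : ℂ)
      = (((h (shiftY i μ z) - h z : ℝ)) : ℂ) + (((h ((shiftY i μ).symm z) - h z : ℝ)) : ℂ) := by
    push_cast
    ring
  rw [e3, add_smul]
  abel

end Laplacian

/-! ## §5 Print's `K(h)` at the genuine `Δ′_a(U)` of (3.24) -/

section Kh

variable {d ℓ : ℕ} {hd : 1 ≤ d + 1} {hL : Odd (ℓ + 1) ∧ 1 < ℓ + 1} {b₀ b₁ : ℝ}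
variable (i : KIdx d ℓ hd hL b₀ b₁)

/-- ★★ **PRINT'S `K(h)` OF (3.88) AT THE GENUINE COVARIANT OPERATOR `Δ′_a(U)`** (def-Y's `Node00.deltaPrimeAY i par U`, any transporter letter `par`):
`K(h)(U) := (h·)∘Δ′_a(U) − Δ′_a(U)∘(h·)`. [cite: Balaban1985BackgroundPropagators, (3.88) p.409] -/
def KhY (par : SiteParY 𝔸 i) (h : SiteY i → ℝ) (U : CfgY 𝔸 i) : (SiteY i → 𝔸) →ₗ[ℂ] (SiteY i → 𝔸) :=
  cutCommY h (deltaPrimeAY i par U)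

/-- `K(h)` unfolded. [cite: Balaban1985BackgroundPropagators, (3.88) p.409, bookkeeping] -/
theorem KhY_def (par : SiteParY 𝔸 i) (h : SiteY i → ℝ) (U : CfgY 𝔸 i) :
    KhY i par h U = cutCommY h (deltaPrimeAY i par U) := rfl

/-- ★ **(3.88) ⇒ the `h388` identity**: `Δ′_a(U)∘(h·) = (h·)∘Δ′_a(U) − K(h)(U)` («(Δ′_a hλ)(x) = h(x)(Δ′_aλ)(x) − (K(h)λ)(x)»).
[cite: Balaban1985BackgroundPropagators, (3.88) p.409] -/
theorem deltaPrimeAY_mul_cutMulY (par : SiteParY 𝔸 i) (h : SiteY i → ℝ) (U : CfgY 𝔸 i) :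
    deltaPrimeAY i par U * cutMulY h = cutMulY h * deltaPrimeAY i par U - KhY i par h U :=
  mul_cutMulY_eq h _

/-- ★ **THE TWO LINES OF (3.88)**: `K(h)(U) = K_Δ(h)(U) + (the averaging commutator)`, the second an explicit kernel operator with kernel
`avgCoeffY(z,w)·(h z − h w)` and def-Y's averaging transport. [cite: Balaban1985BackgroundPropagators, (3.88) p.409] -/
theorem KhY_eq_add (par : SiteParY 𝔸 i) (h : SiteY i → ℝ) (U : CfgY 𝔸 i) :
    KhY i par h U = cutCommY h (lapSL i U) + kernelTrOpY (fun z w => avgCoeffY i z w * (h z - h w)) (avgTrY i par U) := by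
  rw [KhY, deltaPrimeAY, cutCommY_add, cutCommY_kernelTrOpY]

/-- ★★ **THE FULL STENCIL OF `K(h)(U)`** — a bond-local first-order operator (the `2(d+1)` lattice neighbours) plus the semi-local block term:
`(K(h)Λ)(z) = Σ_μ [(h(z+e_μ) − h z)•R(U_μ z)Λ(z+e_μ) + (h(z−e_μ) − h z)•R(U_μ(z−e_μ))⁻¹Λ(z−e_μ)] + Σ_w avgCoeffY(z,w)(h z − h w)•R(avgTr(z,w))Λ(w)`.
[cite: Balaban1985BackgroundPropagators, (3.88) p.409] -/
theorem KhY_apply (par : SiteParY 𝔸 i) (h : SiteY i → ℝ) (U : CfgY 𝔸 i) (Λ : SiteY i → 𝔸) (z : SiteY i) :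
    KhY i par h U Λ z
      = (∑ μ : Fin (d + 1),
          ((((h (shiftY i μ z) - h z : ℝ)) : ℂ) • R (UboxY i U μ z) (Λ (shiftY i μ z))
            + (((h ((shiftY i μ).symm z) - h z : ℝ)) : ℂ) • R (UboxY i U μ ((shiftY i μ).symm z))⁻¹ (Λ ((shiftY i μ).symm z))))
        + ∑ w, (((avgCoeffY i z w * (h z - h w) : ℝ)) : ℂ) • R (avgTrY i par U z w) (Λ w) := by
  rw [KhY_eq_add, LinearMap.add_apply, Pi.add_apply, cutCommY_lapSL_apply, kernelTrOpY_apply]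

/-- the averaging line, read AS PRINTED inside (3.88): `h(z)·(AΛ)(z) − (A(hΛ))(z) = Σ_w K(z,w)(h z − h w)•R(T(z,w))Λ(w)` for def-Y's averaging term.
[cite: Balaban1985BackgroundPropagators, (3.88) p.409 (second line), bookkeeping] -/
theorem KhY_avg_apply (par : SiteParY 𝔸 i) (h : SiteY i → ℝ) (U : CfgY 𝔸 i) (Λ : SiteY i → 𝔸) (z : SiteY i) :
    cutCommY h (kernelTrOpY (avgCoeffY i) (avgTrY i par U)) Λ z
      = ∑ w, (((avgCoeffY i z w * (h z - h w) : ℝ)) : ℂ) • R (avgTrY i par U z w) (Λ w) :=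
  cutCommY_kernelTrOpY_apply h _ _ Λ z

variable {i} in
/-- ★ **`K(h)` IS GAUGE COVARIANT**: `K(h)(U^u)R(u) = R(u)K(h)(U)` for a lawful transporter letter (from def-Y's `deltaPrimeAY_cov` and §1: a real
cut-off commutes with `R(u)`) — p. 398 «All these inequalities are invariant with respect to gauge transformations of U».
[cite: Balaban1985BackgroundPropagators, (3.31)–(3.33) pp.395–396, p.398] -/
theorem KhY_cov {par : SiteParY 𝔸 i} (hS : IsGaugeLawS i par) (g : GaugeY 𝔸 i) (h : SiteY i → ℝ) (U : CfgY 𝔸 i) :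
    Intw (conjY (gSiteY i g)) (conjY (gSiteY i g)) (KhY i par h U) (KhY i par h (gaugeY i g U)) :=
  intw_cutCommY _ h (deltaPrimeAY_cov g U hS)

/-- at `U = 1` (transporters `= 1`) `K(h)` is the commutator of the cut-off with the lift of NODE 00's genuine matrix `Δ′_a = mlOpT` — the flat
`K(h)` of [4] (2.39). [cite: Balaban1984PropagatorsII, (2.38)–(2.39) p.229; Balaban1985BackgroundPropagators, p.395 («coincides with Δ_a … if U = 1»)] -/
theorem KhY_one (par : SiteParY 𝔸 i) (hpar : ∀ z w, par (fun _ _ => 1) z w = 1) (h : SiteY i → ℝ) :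
    KhY i par h (fun _ _ => 1)
      = cutCommY h (liftOpY 𝔸 (B6MultiLevelTorusOperator.mlOpT (toKT i).NB ℓ (toKT i).k (toKT i).D.lev
          (B6MultiLevelBoxOperator.aPrinted ℓ 1))) := by
  rw [KhY, deltaPrimeAY_one i par hpar]

end Kh

/-! ## §6 Locality: «the operator K(h) is semi-local» (p. 410) -/

section Locality

variable {d ℓ : ℕ} {hd : 1 ≤ d + 1} {hL : Odd (ℓ + 1) ∧ 1 < ℓ + 1} {b₀ b₁ : ℝ}
variable (i : KIdx d ℓ hd hL b₀ b₁)

open Classical in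
/-- **THE STENCIL OF `K(h)` AT `z`**: the site itself, its `2(d+1)` lattice neighbours `z ± e_μ`, and the sites `w` of the `L^{lev z}`-block of `z`
(the support of def-Y's averaging coefficient `avgCoeffY i z ·`). [cite: Balaban1985BackgroundPropagators, (3.88) p.409, p.410 («semi-local»)] -/
def stencilY (z : SiteY i) : Finset (SiteY i) :=
  (({z} ∪ Finset.univ.image (fun μ : Fin (d + 1) => shiftY i μ z)) ∪ Finset.univ.image (fun μ : Fin (d + 1) => (shiftY i μ).symm z))
    ∪ Finset.univ.filter (fun w => avgCoeffY i z w ≠ 0)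

/-- `z` is in its stencil. [cite: Balaban1985BackgroundPropagators, (3.88) p.409, bookkeeping] -/
theorem self_mem_stencilY (z : SiteY i) : z ∈ stencilY i z := by
  unfold stencilY
  simp

/-- the forward neighbours are in the stencil. [cite: Balaban1985BackgroundPropagators, (3.88) p.409, bookkeeping] -/
theorem shiftY_mem_stencilY (z : SiteY i) (μ : Fin (d + 1)) : shiftY i μ z ∈ stencilY i z := by
  unfold stencilY
  simp only [Finset.mem_union, Finset.mem_image, Finset.mem_univ, true_and]
  exact Or.inl (Or.inl (Or.inr ⟨μ, rfl⟩))

/-- the backward neighbours are in the stencil. [cite: Balaban1985BackgroundPropagators, (3.88) p.409, bookkeeping] -/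
theorem shiftY_symm_mem_stencilY (z : SiteY i) (μ : Fin (d + 1)) : (shiftY i μ).symm z ∈ stencilY i z := by
  unfold stencilY
  simp only [Finset.mem_union, Finset.mem_image, Finset.mem_univ, true_and]
  exact Or.inl (Or.inr ⟨μ, rfl⟩)

/-- the block of `z` (support of the averaging coefficient) is in the stencil. [cite: Balaban1985BackgroundPropagators, (3.88) p.409, bookkeeping] -/
theorem mem_stencilY_of_avgCoeffY_ne_zero (z w : SiteY i) (hw : avgCoeffY i z w ≠ 0) : w ∈ stencilY i z := by
  classical
  unfold stencilY
  simp only [Finset.mem_union, Finset.mem_filter, Finset.mem_univ, true_and]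
  exact Or.inr hw

/-- ★ **`(K(h)Λ)(z) = 0` WHEN `h` IS CONSTANT ON THE STENCIL OF `z`** (every coefficient of §5's stencil is a difference `h(·) − h(z)` over the stencil).
[cite: Balaban1985BackgroundPropagators, (3.88) p.409, p.410 («semi-local»)] -/
theorem KhY_apply_eq_zero_of_const (par : SiteParY 𝔸 i) (h : SiteY i → ℝ) (U : CfgY 𝔸 i) (Λ : SiteY i → 𝔸) (z : SiteY i)
    (hc : ∀ w ∈ stencilY i z, h w = h z) : KhY i par h U Λ z = 0 := by
  rw [KhY_apply]
  have h1 : ∀ μ : Fin (d + 1), h (shiftY i μ z) - h z = 0 := fun μ => by rw [hc _ (shiftY_mem_stencilY i z μ), sub_self]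
  have h2 : ∀ μ : Fin (d + 1), h ((shiftY i μ).symm z) - h z = 0 := fun μ => by
    rw [hc _ (shiftY_symm_mem_stencilY i z μ), sub_self]
  have h3 : ∀ w, avgCoeffY i z w * (h z - h w) = 0 := fun w => by
    by_cases hw : avgCoeffY i z w = 0
    · rw [hw, zero_mul]
    · rw [hc _ (mem_stencilY_of_avgCoeffY_ne_zero i z w hw), sub_self, mul_zero]
  simp only [h1, h2, h3, Complex.ofReal_zero, zero_smul, add_zero, Finset.sum_const_zero]

/-- ★ **`(K(h)Λ)(z)` DEPENDS ON `Λ` ON THE STENCIL OF `z` ONLY**. [cite: Balaban1985BackgroundPropagators, (3.88) p.409, p.410 («semi-local»)] -/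
theorem KhY_apply_congr (par : SiteParY 𝔸 i) (h : SiteY i → ℝ) (U : CfgY 𝔸 i) {Λ Λ' : SiteY i → 𝔸} (z : SiteY i)
    (hΛ : ∀ w ∈ stencilY i z, Λ w = Λ' w) : KhY i par h U Λ z = KhY i par h U Λ' z := by
  rw [KhY_apply, KhY_apply]
  have h1 : ∀ μ : Fin (d + 1), Λ (shiftY i μ z) = Λ' (shiftY i μ z) := fun μ => hΛ _ (shiftY_mem_stencilY i z μ)
  have h2 : ∀ μ : Fin (d + 1), Λ ((shiftY i μ).symm z) = Λ' ((shiftY i μ).symm z) := fun μ =>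
    hΛ _ (shiftY_symm_mem_stencilY i z μ)
  have h3 : ∀ w, (((avgCoeffY i z w * (h z - h w) : ℝ)) : ℂ) • R (avgTrY i par U z w) (Λ w)
      = (((avgCoeffY i z w * (h z - h w) : ℝ)) : ℂ) • R (avgTrY i par U z w) (Λ' w) := fun w => by
    by_cases hw : avgCoeffY i z w = 0
    · rw [hw, zero_mul, Complex.ofReal_zero, zero_smul, zero_smul]
    · rw [hΛ _ (mem_stencilY_of_avgCoeffY_ne_zero i z w hw)]
  simp only [h1, h2, h3]

/-- ★ **THE WALK ADJACENCY VANISHING** behind «ω = (□₀, □₁, …, □ₙ), □ᵢ ∩ □ᵢ₊₁ ≠ ∅» in (3.90): if `h` is constant on the stencil of every point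
where the cut-off `g` does not vanish, then `(g·)∘K(h)(U) = 0` — so in `G′₀R′ⁿ` only products `h_{□ᵢ}K(h_{□ᵢ₊₁})` of ADJACENT cubes survive.
[cite: Balaban1985BackgroundPropagators, (3.90) p.409, p.410] -/
theorem cutMulY_mul_KhY_eq_zero (par : SiteParY 𝔸 i) (g h : SiteY i → ℝ) (U : CfgY 𝔸 i)
    (hg : ∀ z, g z ≠ 0 → ∀ w ∈ stencilY i z, h w = h z) : cutMulY g * KhY i par h U = 0 := by
  refine LinearMap.ext fun Λ => funext fun z => ?_
  rw [Module.End.mul_apply, cutMulY_apply, LinearMap.zero_apply, Pi.zero_apply]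
  by_cases hz : g z = 0
  · rw [hz, Complex.ofReal_zero, zero_smul]
  · rw [KhY_apply_eq_zero_of_const i par h U Λ z (hg z hz), smul_zero]

end Locality

/-! ## §7 (3.87)–(3.88) summed at the letters: «Δ′_aG′₀ = I − Σ_□ K(h_□)G′_□h_□ = I − R′» and the fixed point -/

section Sum

variable {d ℓ : ℕ} {hd : 1 ≤ d + 1} {hL : Odd (ℓ + 1) ∧ 1 < ℓ + 1} {b₀ b₁ : ℝ}
variable (i : KIdx d ℓ hd hL b₀ b₁)

/-- ★★ **«Δ′_aG′₀ = I − Σ_□ K(h_□)G′_□h_□»** at def-Y's genuine `Δ′_a(U)`, for ANY real family `hf` with `Σ_c hf_c² = 1` and ANY family of cube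
operators `Gl c` with the LOCAL-INVERSE property `h_c∘Δ′_a(U)∘G_c∘h_c = h_c²` (print: `G′_□` is the propagator of the sequence `{Ω_n(□)}`, `Ω₀(□) ⊃ □̃ ⊃
supp h_□`, so it inverts `Δ′_a` where `h_□` lives — a HYPOTHESIS here, the content of modules M5.1a ∕ M5.2): with `G′₀ := Σ_c h_c G_c h_c` (3.87) and
`R′ := Σ_c K(h_c) G_c h_c`, `Δ′_a(U) G′₀ = 1 − R′` — `B9Thm37Sum.eq388_sum` in the ring `End_ℂ(SiteY i → 𝔸)` with `h388` DISCHARGED by §5.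
[cite: Balaban1985BackgroundPropagators, (3.87)–(3.88) p.409] -/
theorem eq388_deltaPrimeAY (par : SiteParY 𝔸 i) (U : CfgY 𝔸 i) {ι : Type} [Fintype ι] (hf : ι → SiteY i → ℝ)
    (hsq : ∀ z, ∑ c, hf c z ^ 2 = 1) (Gl : ι → Module.End ℂ (SiteY i → 𝔸))
    (hloc : ∀ c, cutMulY (hf c) * deltaPrimeAY i par U * Gl c * cutMulY (hf c) = cutMulY (hf c) * cutMulY (hf c)) :
    deltaPrimeAY i par U * (∑ c, cutMulY (hf c) * Gl c * cutMulY (hf c))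
      = 1 - ∑ c, KhY i par (hf c) U * Gl c * cutMulY (hf c) :=
  B9Thm37Sum.eq388_sum (deltaPrimeAY i par U) (fun c => cutMulY (hf c)) Gl (fun c => KhY i par (hf c) U)
    (fun c => deltaPrimeAY_mul_cutMulY i par (hf c) U) hloc (sum_cutMulY_mul_self hf hsq)

/-- ★ **(3.90), first equality, as the fixed point the estimates consume**: any LEFT INVERSE `G′` of `Δ′_a(U)` (Thm 3.11 ∕ M5.3's `G′(U)`) satisfies
`G′ = G′₀ + G′R′` («G′ = G′₀(I − R′)⁻¹ = G′₀ Σ_n R′ⁿ» read without inverting `I − R′`). [cite: Balaban1985BackgroundPropagators, (3.90) p.409] -/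
theorem fixedPoint388_deltaPrimeAY (par : SiteParY 𝔸 i) (U : CfgY 𝔸 i) {ι : Type} [Fintype ι] (hf : ι → SiteY i → ℝ)
    (hsq : ∀ z, ∑ c, hf c z ^ 2 = 1) (Gl : ι → Module.End ℂ (SiteY i → 𝔸))
    (hloc : ∀ c, cutMulY (hf c) * deltaPrimeAY i par U * Gl c * cutMulY (hf c) = cutMulY (hf c) * cutMulY (hf c))
    {G' : Module.End ℂ (SiteY i → 𝔸)} (hinv : G' * deltaPrimeAY i par U = 1) :
    G' = (∑ c, cutMulY (hf c) * Gl c * cutMulY (hf c)) + G' * ∑ c, KhY i par (hf c) U * Gl c * cutMulY (hf c) :=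
  B9Thm37Sum.fixedPoint_of_388 hinv (eq388_deltaPrimeAY i par U hf hsq Gl hloc)

/-- `M_h ≥ 1` and `P′_μ ≥ 1` for a k-level member (from `KIdx.hM8`, `KIdx.hP5`) — the side conditions of the partition of record.
[cite: Balaban1984PropagatorsII, (2.1) p.224, bookkeeping] -/
theorem one_le_Mh_and_P (i : KIdx d ℓ hd hL b₀ b₁) : 1 ≤ i.Mh ∧ ∀ μ, 1 ≤ i.P' μ :=
  ⟨le_trans (by norm_num) i.hM8, fun μ => le_trans (by norm_num) (i.hP5 μ)⟩

/-- **THE PARTITION OF RECORD `h_□ = hT i.D □` READ ON def-Y's CARRIER `SiteY i`** (the same type `↥(boxDom (N0 ℓ i.Mh i.k i.P′))`: this seat's gen-26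
periodic partition (2.36) of `T_η`, [Balaban1984PropagatorsII] p. 229 = [Balaban1985BackgroundPropagators] p. 408 «the partition of unity {h_□} defined at
the end of Sect. A in [4]»). [cite: Balaban1985BackgroundPropagators, p.408; Balaban1984PropagatorsII, (2.36) p.229] -/
abbrev hTY (c : ↥(cubes i.D.toDomains)) : SiteY i → ℝ := fun z => hT i.D c z

/-- `hTY` is `hT`. [cite: Balaban1985BackgroundPropagators, p.408, bookkeeping] -/
theorem hTY_apply (c : ↥(cubes i.D.toDomains)) (z : SiteY i) : hTY i c z = hT i.D c z := rfl

/-- **«Σ_{□∈𝒟} h_□² = 1» on def-Y's carrier.** [cite: Balaban1985BackgroundPropagators, p.408; Balaban1984PropagatorsII, (2.36) p.229] -/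
theorem sum_hTY_sq (z : SiteY i) : ∑ c, hTY i c z ^ 2 = 1 :=
  sum_hT_sq i.D (one_le_Mh_and_P i).1 (one_le_Mh_and_P i).2 z

omit [CompleteSpace 𝔸] in
/-- **«We have Σ_{□∈𝒟} h_□² = 1» FOR THE PARTITION OF RECORD on def-Y's carrier**: `Σ_□ (h_□·)(h_□·) = 1` with `h_□ = hT i.D □` (this seat's
gen-26 periodic partition (2.36) of `T_η`, read on `SiteY i` — the same type). [cite: Balaban1985BackgroundPropagators, p.408; Balaban1984PropagatorsII, (2.36) p.229] -/
theorem sum_cutMulY_hT_mul_self :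
    ∑ c : ↥(cubes i.D.toDomains), cutMulY (𝔸 := 𝔸) (hTY i c) * cutMulY (hTY i c) = 1 :=
  sum_cutMulY_mul_self (hTY i) (sum_hTY_sq i)

/-- ★★ **(3.87)–(3.88) AT THE PARTITION OF RECORD**: `Δ′_a(U) · Σ_□ h_□G_□h_□ = 1 − Σ_□ K(h_□)(U)G_□h_□` over the cubes `□ ∈ 𝒟` of the member's
cover, for any cube-operator family with the local-inverse property. [cite: Balaban1985BackgroundPropagators, (3.87)–(3.88) p.409] -/
theorem eq388_hT (par : SiteParY 𝔸 i) (U : CfgY 𝔸 i) (Gl : ↥(cubes i.D.toDomains) → Module.End ℂ (SiteY i → 𝔸))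
    (hloc : ∀ c, cutMulY (hTY i c) * deltaPrimeAY i par U * Gl c * cutMulY (hTY i c) = cutMulY (hTY i c) * cutMulY (hTY i c)) :
    deltaPrimeAY i par U * (∑ c, cutMulY (hTY i c) * Gl c * cutMulY (hTY i c))
      = 1 - ∑ c, KhY i par (hTY i c) U * Gl c * cutMulY (hTY i c) :=
  eq388_deltaPrimeAY i par U (hTY i) (sum_hTY_sq i) Gl hloc

/-- ★ the fixed point AT THE PARTITION OF RECORD: `G′ = Σ_□ h_□G_□h_□ + G′ · Σ_□ K(h_□)(U)G_□h_□` for any left inverse `G′` of `Δ′_a(U)`.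
[cite: Balaban1985BackgroundPropagators, (3.90) p.409] -/
theorem fixedPoint388_hT (par : SiteParY 𝔸 i) (U : CfgY 𝔸 i) (Gl : ↥(cubes i.D.toDomains) → Module.End ℂ (SiteY i → 𝔸))
    (hloc : ∀ c, cutMulY (hTY i c) * deltaPrimeAY i par U * Gl c * cutMulY (hTY i c) = cutMulY (hTY i c) * cutMulY (hTY i c))
    {G' : Module.End ℂ (SiteY i → 𝔸)} (hinv : G' * deltaPrimeAY i par U = 1) :
    G' = (∑ c, cutMulY (hTY i c) * Gl c * cutMulY (hTY i c)) + G' * ∑ c, KhY i par (hTY i c) U * Gl c * cutMulY (hTY i c) :=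
  fixedPoint388_deltaPrimeAY i par U (hTY i) (sum_hTY_sq i) Gl hloc hinv

end Sum

end Literature.MathematicalPhysics.QuantumFieldTheory.Balaban1983to89.B9Thm37CubeCoverCommutators

end
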